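import Summits.CriticalPhenomena.CardyFormulaZ2.Theorems.CardySelfRefinementLagHandOffKernelFlatGeometry
import Summits.CriticalPhenomena.CardyFormulaZ2.Theorems.CardySelfRefinementLagHandOffKernelCorner
import HarnessLib

/-!
# Flat BNM: corrected stub `stub_kernel_flatPieceMisdockVanishes2` of line `hitting-tournament`
for crux `LagHandOff` (stmt-CriticalPhenomena-10268)

The flat "boundary: no macroscopic misdock" (BNM) step of the boundary kernel (seat c6).
Vocabulary (K5): discrete Dobrushin data `E δ` of a `ℤ²`-discretisation family of a Dobrushin
domain `D` (`ZdDiscretisationFamily`), `Ω_δ = discreteDomainGraph (E δ).Ω (E δ).δ`, the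
restricted configuration `ω° = ω ∩ E(Ω_δ)`, and the `ω°`-cluster `K(c)` of a non-arc site `c`
inside `Ω_δ ∖ (zdArcA ∪ zdArcB)` (`openConnIn`); `K(c)` is MISDOCKED when no `ω`-open contact
edge of `Ω_δ` into the discrete wired arc `zdArcA` is reachable from `c`.

Statement.  Under a flat horizontal piece of the wired arc (the open slab
`(a₁, a₂) × (y₀, y₀ + η)` inside `D`, the half-closed slab `(a₁, a₂) × (y₀ - η, y₀]` outside,
the closed upper slab at distance `≥ η` from `D.arc 1`), with null boundary, and GIVEN the strip
bound `hS` (the sibling stub `stub_kernel_flatStripMisdock2`, taken verbatim as hypothesis):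
for all `L, θ > 0` there is `ρ > 0` such that for all small meshes `δ`, the probability that
some misdocked cluster `K(c)` contains a site `y` with abscissa in `[a₁ + 3η, a₂ - 3η]` and
height in `(y₀, y₀ + ρ]`, and two sites at mesh distance `≥ L`, is `< θ`.

The registered stub `stub_kernel_flatPieceMisdockVanishes` omits the lower bound
`y₀ < (meshPoint (E δ).δ y).im`; without it the event contains macroscopic bulk clusters of
parts of `D` lying below height `y₀ - η` (a horseshoe-shaped `D`), whose probability does not
vanish.  This file proves the corrected statement (`…Vanishes2`, registered on the crux).

Proof.  Constants: `t ∈ (0, 1]` with `t ^ α_c ≤ θ/4` (`α_c, c₀` from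
`stub_kernel_cornerNearMiss`), `R = min (L/6) (η t/16)`, and `ρ > 0` with `2Kρ ≤ R`,
`C ((a₂ - a₁)/ρ + 1) (ρ/R)^{1+α} ≤ θ/4` (`C, α, H₀, K` from `hS`; `exists_strip_const`).
For small `δ` (flat geometry from `stub_kernel_flatPieceGeometry`, admissibility, and finitely
many linear smallness conditions) take the box `j = ⌈(a₁ + 3η/2)/δ⌉`,
`N = ⌊(a₂ - 3η/2 - jδ)/δ⌋₊`, `M = ⌈(4R + ρ + 2δ)/δ⌉₊`, `b = ⌊y₀/δ⌋ + 2`.  Pointwise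
(`KernelFlatBNM.trichotomy`, deterministic): a configuration of the target event has `y` in
columns `[j, j + N]` and rows `≥ b` (row `b - 1` is wired by (F1), `y` is not), so the sites of
`K(c)` with column in `[j, j + N]` and row `≥ b` have a LOWEST one, `z`
(`Int.exists_least_of_bdd`), with `(z 1 - b) δ ≤ ρ`; either `z` is `≥ 4R` from both strip ends
— the event of `hS` at `H = ρ` (far pair `y₁, y₂`, `6R ≤ L`) — or `z` is within `5R` of an
end point `p = (a₁ + 3η/2, y₀)` / `(a₂ - 3η/2, y₀)` while `y` is `≥ 3η/2` from `p` — the corner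
event of `stub_kernel_cornerNearMiss` at radii `(5R, 3η/2)`.  The union bound
(`measureReal_mono`, `measureReal_union_le`) gives `≤ 3θ/4 < θ`.

References: G. F. Lawler, O. Schramm, W. Werner, Electron. J. Probab. 7 (2002), Appendix A
[LawlerSchrammWernerEJP2002]; S. Smirnov, W. Werner, Math. Res. Lett. 8 (2001), §3
[SmirnovWerner2001] (boundary arm exponents behind `hS` and the corner bound; nothing new is
cited here).
-/

noncomputable section

open MeasureTheory Filter Set Topology Metric
open Literature.Probability.Percolation Literature.Probability.LatticeModels
open Literature.Probability.RandomPlanarGeometry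

namespace Summit.CriticalPhenomena.CardyFormulaZ2.Cruxes.LagHandOff.HittingTournament

namespace KernelFlatBNM

/-! ### Small meshes and constants -/

/-- Positive meshes are eventually below any positive threshold. -/
theorem eventually_le_nhdsGT {ε : ℝ} (hε : 0 < ε) : ∀ᶠ δ in 𝓝[>] (0 : ℝ), δ ≤ ε :=
  mem_nhdsWithin_of_mem_nhds (Iic_mem_nhds hε)

/-- Corner constant: some `t ∈ (0, 1]` has `t ^ α ≤ θ / 4`. -/
theorem exists_corner_const {α θ : ℝ} (hα : 0 < α) (hθ : 0 < θ) :
    ∃ t : ℝ, 0 < t ∧ t ≤ 1 ∧ t ^ α ≤ θ / 4 := by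
  refine ⟨min 1 ((θ / 4) ^ α⁻¹), lt_min one_pos (Real.rpow_pos_of_pos (by positivity) _),
    min_le_left _ _, ?_⟩
  calc (min 1 ((θ / 4) ^ α⁻¹)) ^ α ≤ ((θ / 4) ^ α⁻¹) ^ α :=
        Real.rpow_le_rpow (le_min zero_le_one (Real.rpow_nonneg (by positivity) _))
          (min_le_right _ _) hα.le
    _ = θ / 4 := Real.rpow_inv_rpow (by positivity) hα.ne'

/-- Strip constant: for `C, α, R > 0`, `K ≥ 1`, `A ≥ 0`, `θ > 0` some `ρ > 0` has `2 K ρ ≤ R`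
and `C (A / ρ + 1) (ρ / R) ^ (1 + α) ≤ θ / 4` (the left side is `O(ρ ^ α)` as `ρ → 0`). -/
theorem exists_strip_const {C α R K A θ : ℝ} (hC : 0 < C) (hα : 0 < α) (hR : 0 < R)
    (hK : 1 ≤ K) (hA : 0 ≤ A) (hθ : 0 < θ) :
    ∃ ρ : ℝ, 0 < ρ ∧ 2 * K * ρ ≤ R ∧ C * (A / ρ + 1) * (ρ / R) ^ (1 + α) ≤ θ / 4 := by
  set q : ℝ := θ / (4 * (C * (A / R + 1))) with hq
  have hq0 : 0 < q := by positivity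
  set s : ℝ := min (1 / (2 * K)) (q ^ α⁻¹) with hs
  have hs0 : 0 < s := lt_min (by positivity) (Real.rpow_pos_of_pos hq0 _)
  have hsK : s ≤ 1 / (2 * K) := min_le_left _ _
  have hs1 : s ≤ 1 := hsK.trans (by rw [div_le_one (by positivity)]; linarith)
  have hsq : s ^ α ≤ q :=
    calc s ^ α ≤ (q ^ α⁻¹) ^ α := Real.rpow_le_rpow hs0.le (min_le_right _ _) hα.le
      _ = q := Real.rpow_inv_rpow hq0.le hα.ne'
  refine ⟨R * s, mul_pos hR hs0, ?_, ?_⟩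
  · have h := mul_le_mul_of_nonneg_left hsK (by positivity : (0 : ℝ) ≤ 2 * K * R)
    calc 2 * K * (R * s) = 2 * K * R * s := by ring
      _ ≤ 2 * K * R * (1 / (2 * K)) := h
      _ = R := by field_simp
  · have hρR : R * s / R = s := by field_simp
    rw [hρR, Real.rpow_add hs0, Real.rpow_one]
    calc C * (A / (R * s) + 1) * (s * s ^ α) = C * (A / R + s) * s ^ α := by
          field_simp
      _ ≤ C * (A / R + 1) * q :=
          mul_le_mul (by gcongr) hsq (Real.rpow_nonneg hs0.le _) (by positivity)
      _ = θ / 4 := by rw [hq]; field_simp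

/-! ### Lattice helpers -/

/-- A nonempty family of sites whose rows are bounded below has a lowest site. -/
theorem exists_lowest {P : Site 2 → Prop} {b : ℤ} (hP : ∀ v, P v → b ≤ v 1) {y : Site 2}
    (hy : P y) : ∃ z : Site 2, P z ∧ z 1 ≤ y 1 ∧ ∀ w, P w → z 1 ≤ w 1 := by
  obtain ⟨m, ⟨z, hz, hzm⟩, hmin⟩ :=
    Int.exists_least_of_bdd (P := fun m => ∃ v, P v ∧ v 1 = m)
      ⟨b, fun m ⟨v, hv, hvm⟩ => hvm ▸ hP v hv⟩ ⟨y 1, y, hy, rfl⟩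
  exact ⟨z, hz, hzm ▸ hmin _ ⟨y, hy, rfl⟩, fun w hw => hzm ▸ hmin _ ⟨w, hw, rfl⟩⟩

/-! ### The trichotomy -/

/-- **Trichotomy** (deterministic core of the flat BNM).  In a flat box with the bookkeeping
of the module docstring, a configuration of the target event (a misdocked `ω°`-cluster with a
site of abscissa in `[a₁ + 3η, a₂ - 3η]` and height in `(y₀, y₀ + ρ]`, and two sites `≥ L`
apart) lies in the strip event of `stub_kernel_flatStripMisdock2` (at `H = ρ`) or in one of the
two corner events of `stub_kernel_cornerNearMiss` at the end points `(a₁ + 3η/2, y₀)`,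
`(a₂ - 3η/2, y₀)` with radii `(5R, 3η/2)`. -/
theorem trichotomy {E : DiscreteDobrushin} {δ a₁ a₂ y₀ η ρ R L : ℝ} {j b : ℤ} {N M : ℕ}
    (hd : E.δ = δ) (hδ : 0 < δ) (hRL : 6 * R ≤ L) (hδρR : δ + ρ ≤ R) (hρM : ρ ≤ M * δ)
    (hδη : δ ≤ η) (hb1 : δ * ((b : ℝ) - 2) ≤ y₀) (hb2 : y₀ < δ * ((b : ℝ) - 1))
    (hj1 : a₁ + 3 * η / 2 ≤ (j : ℝ) * δ) (hj2 : (j : ℝ) * δ < a₁ + 3 * η / 2 + δ)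
    (hN1 : a₂ - 3 * η / 2 - δ < ((j + N : ℤ) : ℝ) * δ)
    (hN2 : ((j + N : ℤ) : ℝ) * δ ≤ a₂ - 3 * η / 2)
    (hF1 : ∀ v : Site 2, j - M ≤ v 0 → v 0 ≤ j + N + M → b - 1 ≤ v 1 → v 1 ≤ b + M →
      v ∈ meshDomain E.Ω E.δ ∧ (v ∈ E.zdArcA ↔ v 1 = b - 1) ∧ v ∉ E.zdArcB) :
    {ω : BondConfig (Site 2) | ∃ c y y₁ y₂ : Site 2, c ∈ meshDomain E.Ω E.δ ∧
        c ∉ E.zdArcA ∪ E.zdArcB ∧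
        (¬ ∃ u u' : Site 2, u' ∈ E.zdArcA ∧ u ∉ E.zdArcA ∪ E.zdArcB ∧ s(u, u') ∈ ω ∧
          s(u, u') ∈ (discreteDomainGraph E.Ω E.δ).edgeSet ∧
          (ω ∩ (discreteDomainGraph E.Ω E.δ).edgeSet) ∈
            openConnIn (meshDomain E.Ω E.δ \ (E.zdArcA ∪ E.zdArcB)) c u) ∧
        (ω ∩ (discreteDomainGraph E.Ω E.δ).edgeSet) ∈
          openConnIn (meshDomain E.Ω E.δ \ (E.zdArcA ∪ E.zdArcB)) c y ∧
        a₁ + 3 * η ≤ (meshPoint E.δ y).re ∧ (meshPoint E.δ y).re ≤ a₂ - 3 * η ∧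
        y₀ < (meshPoint E.δ y).im ∧ (meshPoint E.δ y).im ≤ y₀ + ρ ∧
        (ω ∩ (discreteDomainGraph E.Ω E.δ).edgeSet) ∈
          openConnIn (meshDomain E.Ω E.δ \ (E.zdArcA ∪ E.zdArcB)) c y₁ ∧
        (ω ∩ (discreteDomainGraph E.Ω E.δ).edgeSet) ∈
          openConnIn (meshDomain E.Ω E.δ \ (E.zdArcA ∪ E.zdArcB)) c y₂ ∧
        L ≤ dist (meshPoint E.δ y₁) (meshPoint E.δ y₂)} ⊆
    {ω | ∃ c z : Site 2, c ∈ meshDomain E.Ω E.δ ∧ c ∉ E.zdArcA ∪ E.zdArcB ∧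
        (¬ ∃ u u' : Site 2, u' ∈ E.zdArcA ∧ u ∉ E.zdArcA ∪ E.zdArcB ∧ s(u, u') ∈ ω ∧
          s(u, u') ∈ (discreteDomainGraph E.Ω E.δ).edgeSet ∧
          (ω ∩ (discreteDomainGraph E.Ω E.δ).edgeSet) ∈
            openConnIn (meshDomain E.Ω E.δ \ (E.zdArcA ∪ E.zdArcB)) c u) ∧
        (∃ y₁ y₂ : Site 2, (ω ∩ (discreteDomainGraph E.Ω E.δ).edgeSet) ∈
            openConnIn (meshDomain E.Ω E.δ \ (E.zdArcA ∪ E.zdArcB)) c y₁ ∧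
          (ω ∩ (discreteDomainGraph E.Ω E.δ).edgeSet) ∈
            openConnIn (meshDomain E.Ω E.δ \ (E.zdArcA ∪ E.zdArcB)) c y₂ ∧
          6 * R ≤ dist (meshPoint E.δ y₁) (meshPoint E.δ y₂)) ∧
        (ω ∩ (discreteDomainGraph E.Ω E.δ).edgeSet) ∈
          openConnIn (meshDomain E.Ω E.δ \ (E.zdArcA ∪ E.zdArcB)) c z ∧
        j ≤ z 0 ∧ z 0 ≤ j + N ∧ b ≤ z 1 ∧ ((z 1 - b : ℤ) : ℝ) * E.δ ≤ ρ ∧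
        (∀ y : Site 2, (ω ∩ (discreteDomainGraph E.Ω E.δ).edgeSet) ∈
            openConnIn (meshDomain E.Ω E.δ \ (E.zdArcA ∪ E.zdArcB)) c y →
          j ≤ y 0 → y 0 ≤ j + N → b ≤ y 1 → z 1 ≤ y 1) ∧
        (j : ℝ) * E.δ + 4 * R ≤ (z 0 : ℝ) * E.δ ∧
        (z 0 : ℝ) * E.δ + 4 * R ≤ ((j + N : ℤ) : ℝ) * E.δ} ∪
    ({ω | ∃ c y₀' y₁ : Site 2,
        (ω ∩ (discreteDomainGraph E.Ω E.δ).edgeSet) ∈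
            openConnIn (meshDomain E.Ω E.δ \ (E.zdArcA ∪ E.zdArcB)) c y₀' ∧
          (ω ∩ (discreteDomainGraph E.Ω E.δ).edgeSet) ∈
            openConnIn (meshDomain E.Ω E.δ \ (E.zdArcA ∪ E.zdArcB)) c y₁ ∧
          dist (meshPoint E.δ y₀') (⟨a₁ + 3 * η / 2, y₀⟩ : ℂ) ≤ 5 * R ∧
          3 * η / 2 ≤ dist (meshPoint E.δ y₁) (⟨a₁ + 3 * η / 2, y₀⟩ : ℂ)} ∪
      {ω | ∃ c y₀' y₁ : Site 2,
        (ω ∩ (discreteDomainGraph E.Ω E.δ).edgeSet) ∈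
            openConnIn (meshDomain E.Ω E.δ \ (E.zdArcA ∪ E.zdArcB)) c y₀' ∧
          (ω ∩ (discreteDomainGraph E.Ω E.δ).edgeSet) ∈
            openConnIn (meshDomain E.Ω E.δ \ (E.zdArcA ∪ E.zdArcB)) c y₁ ∧
          dist (meshPoint E.δ y₀') (⟨a₂ - 3 * η / 2, y₀⟩ : ℂ) ≤ 5 * R ∧
          3 * η / 2 ≤ dist (meshPoint E.δ y₁) (⟨a₂ - 3 * η / 2, y₀⟩ : ℂ)}) := by
  subst hd
  rintro ω ⟨c, y, y₁, y₂, hc, hcA, hmis, hy, hyr1, hyr2, hyi1, hyi2, hy₁, hy₂, hL⟩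
  rw [meshPoint_re] at hyr1 hyr2
  rw [meshPoint_im] at hyi1 hyi2
  have hyS : y ∉ E.zdArcA ∪ E.zdArcB := by
    obtain ⟨_, hyS, _⟩ := hy
    exact hyS.2
  -- the column and the row of `y`
  have hjy : j ≤ y 0 := by
    have h : (j : ℝ) * E.δ < (y 0 : ℝ) * E.δ := by linarith
    exact (Int.cast_lt.1 (lt_of_mul_lt_mul_right h hδ.le)).le
  have hyN : y 0 ≤ j + N := by
    have h : (y 0 : ℝ) * E.δ < ((j + N : ℤ) : ℝ) * E.δ := by linarith
    exact (Int.cast_lt.1 (lt_of_mul_lt_mul_right h hδ.le)).le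
  have hyb : b - 1 ≤ y 1 := by
    have h : ((b - 2 : ℤ) : ℝ) * E.δ < (y 1 : ℝ) * E.δ := by push_cast; linarith
    have := Int.cast_lt.1 (lt_of_mul_lt_mul_right h hδ.le)
    omega
  have hyM : y 1 ≤ b + M := by
    have h : (y 1 : ℝ) * E.δ < ((b - 1 + M : ℤ) : ℝ) * E.δ := by push_cast; linarith
    have := Int.cast_lt.1 (lt_of_mul_lt_mul_right h hδ.le)
    omega
  have hby : b ≤ y 1 := by
    rcases eq_or_lt_of_le hyb with h | h
    · exact absurd (((hF1 y (by omega) (by omega) (by omega) hyM).2.1).2 h.symm)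
        fun hA => hyS (Or.inl hA)
    · omega
  -- the lowest strip site `z`
  obtain ⟨z, ⟨hz, hjz, hzN, hbz⟩, hzy, hmin⟩ := exists_lowest
    (P := fun v => (ω ∩ (discreteDomainGraph E.Ω E.δ).edgeSet) ∈
        openConnIn (meshDomain E.Ω E.δ \ (E.zdArcA ∪ E.zdArcB)) c v ∧
      j ≤ v 0 ∧ v 0 ≤ j + N ∧ b ≤ v 1) (fun v hv => hv.2.2.2) ⟨hy, hjy, hyN, hby⟩
  have hlow : ∀ w : Site 2, (ω ∩ (discreteDomainGraph E.Ω E.δ).edgeSet) ∈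
      openConnIn (meshDomain E.Ω E.δ \ (E.zdArcA ∪ E.zdArcB)) c w →
      j ≤ w 0 → w 0 ≤ j + N → b ≤ w 1 → z 1 ≤ w 1 :=
    fun w h1 h2 h3 h4 => hmin w ⟨h1, h2, h3, h4⟩
  have ezy : ((z 1 : ℤ) : ℝ) * E.δ ≤ (y 1 : ℝ) * E.δ :=
    mul_le_mul_of_nonneg_right (Int.cast_le.2 hzy) hδ.le
  have ebz : ((b : ℤ) : ℝ) * E.δ ≤ (z 1 : ℝ) * E.δ :=
    mul_le_mul_of_nonneg_right (Int.cast_le.2 hbz) hδ.le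
  have hzH : ((z 1 - b : ℤ) : ℝ) * E.δ ≤ ρ := by push_cast; linarith
  -- heights of `z`: in `(y₀, y₀ + ρ]`
  have hzi : |E.δ * (z 1 : ℝ) - y₀| ≤ ρ := abs_le.2 ⟨by linarith, by linarith⟩
  by_cases hl : (j : ℝ) * E.δ + 4 * R ≤ (z 0 : ℝ) * E.δ
  · by_cases hr : (z 0 : ℝ) * E.δ + 4 * R ≤ ((j + N : ℤ) : ℝ) * E.δ
    · exact Or.inl ⟨c, z, hc, hcA, hmis, ⟨y₁, y₂, hy₁, hy₂, hRL.trans hL⟩, hz, hjz, hzN, hbz,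
        hzH, hlow, hl, hr⟩
    · -- `z` is within `4R` of the right end of the strip
      refine Or.inr (Or.inr ⟨c, z, y, hz, hy, ?_, ?_⟩)
      · rw [Complex.dist_eq]
        refine (Complex.norm_le_abs_re_add_abs_im _).trans ?_
        rw [Complex.sub_re, Complex.sub_im, meshPoint_re, meshPoint_im]
        have ezN : ((z 0 : ℤ) : ℝ) * E.δ ≤ ((j + N : ℤ) : ℝ) * E.δ :=
          mul_le_mul_of_nonneg_right (Int.cast_le.2 hzN) hδ.le
        have hzr : |E.δ * (z 0 : ℝ) - (a₂ - 3 * η / 2)| ≤ 4 * R + E.δ :=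
          abs_le.2 ⟨by linarith, by linarith⟩
        change |E.δ * (z 0 : ℝ) - (a₂ - 3 * η / 2)| + |E.δ * (z 1 : ℝ) - y₀| ≤ 5 * R
        linarith
      · rw [Complex.dist_eq]
        refine le_trans ?_ (Complex.abs_re_le_norm _)
        rw [Complex.sub_re, meshPoint_re]
        change 3 * η / 2 ≤ |E.δ * (y 0 : ℝ) - (a₂ - 3 * η / 2)|
        exact le_abs.2 (Or.inr (by linarith))
  · -- `z` is within `4R` of the left end of the strip
    refine Or.inr (Or.inl ⟨c, z, y, hz, hy, ?_, ?_⟩)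
    · rw [Complex.dist_eq]
      refine (Complex.norm_le_abs_re_add_abs_im _).trans ?_
      rw [Complex.sub_re, Complex.sub_im, meshPoint_re, meshPoint_im]
      have ejz : ((j : ℤ) : ℝ) * E.δ ≤ (z 0 : ℝ) * E.δ :=
        mul_le_mul_of_nonneg_right (Int.cast_le.2 hjz) hδ.le
      have hzr : |E.δ * (z 0 : ℝ) - (a₁ + 3 * η / 2)| ≤ 4 * R + E.δ :=
        abs_le.2 ⟨by linarith, by linarith⟩
      change |E.δ * (z 0 : ℝ) - (a₁ + 3 * η / 2)| + |E.δ * (z 1 : ℝ) - y₀| ≤ 5 * R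
      linarith
    · rw [Complex.dist_eq]
      refine le_trans ?_ (Complex.abs_re_le_norm _)
      rw [Complex.sub_re, meshPoint_re]
      change 3 * η / 2 ≤ |E.δ * (y 0 : ℝ) - (a₁ + 3 * η / 2)|
      exact le_abs.2 (Or.inl (by linarith))

end KernelFlatBNM

set_option maxHeartbeats 400000 in
open KernelFlatGeometry KernelFlatBNM in
/-- **Flat BNM** (corrected stub `stub_kernel_flatPieceMisdockVanishes2` of line `hitting-tournament`,
crux `LagHandOff`).  Given the strip bound `hS` (`stub_kernel_flatStripMisdock2`), under a flat
horizontal piece of the wired arc of a Dobrushin domain with null boundary, discretised along a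
`ℤ²`-family: for every `L, θ > 0` there is `ρ > 0` such that for all small meshes the probability
that some misdocked `ω°`-cluster contains a site of abscissa in `[a₁ + 3η, a₂ - 3η]` and height in
`(y₀, y₀ + ρ]` together with two sites at distance `≥ L` is `< θ`.  Proof: union bound over the
trichotomy `KernelFlatBNM.trichotomy` — the strip term is bounded by `hS` (flat geometry from
`stub_kernel_flatPieceGeometry`, `H = ρ`, `R = min (L/6) (η t/16)`), the two end terms by
`stub_kernel_cornerNearMiss` at radii `(5R, 3η/2)`; `ρ` and `t` are chosen so that each term is
`≤ θ / 4`. -/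
theorem stub_kernel_flatPieceMisdockVanishes2 : (∃ C α : ℝ, 0 < C ∧ 0 < α ∧ ∃ H₀ K : ℝ, 1 ≤ H₀ ∧ 1 ≤ K ∧ ∀ (E : DiscreteDobrushin), E.IsZdAdmissible → ∀ (b j : ℤ) (N M : ℕ) (H R : ℝ), 1 ≤ N → H₀ * E.δ ≤ H → K * H ≤ R → (∀ v : Site 2, j - M ≤ v 0 → v 0 ≤ j + N + M → b - 1 ≤ v 1 → v 1 ≤ b + M → v ∈ meshDomain E.Ω E.δ ∧ (v ∈ E.zdArcA ↔ v 1 = b - 1) ∧ v ∉ E.zdArcB) → (∀ v w : Site 2, j - M ≤ v 0 → v 0 ≤ j + N + M → b - 1 ≤ v 1 → v 1 ≤ b + M → j - M ≤ w 0 → w 0 ≤ j + N + M → b - 1 ≤ w 1 → w 1 ≤ b + M → (zdGraph 2).Adj v w → (discreteDomainGraph E.Ω E.δ).Adj v w) → 4 * R + H + 2 * E.δ ≤ M * E.δ → (bondPercolation (zdGraph 2) half).real {ω | ∃ c z : Site 2, c ∈ meshDomain E.Ω E.δ ∧ c ∉ E.zdArcA ∪ E.zdArcB ∧ (¬ ∃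 u u' : Site 2, u' ∈ E.zdArcA ∧ u ∉ E.zdArcA ∪ E.zdArcB ∧ s(u, u') ∈ ω ∧ s(u, u') ∈ (discreteDomainGraph E.Ω E.δ).edgeSet ∧ (ω ∩ (discreteDomainGraph E.Ω E.δ).edgeSet) ∈ openConnIn (meshDomain E.Ω E.δ \ (E.zdArcA ∪ E.zdArcB)) c u) ∧ (∃ y₁ y₂ : Site 2, (ω ∩ (discreteDomainGraph E.Ω E.δ).edgeSet) ∈ openConnIn (meshDomain E.Ω E.δ \ (E.zdArcA ∪ E.zdArcB)) c y₁ ∧ (ω ∩ (discreteDomainGraph E.Ω E.δ).edgeSet) ∈ openConnIn (meshDomain E.Ω E.δ \ (E.zdArcA ∪ E.zdArcB)) c y₂ ∧ 6 * R ≤ dist (meshPoint E.δ y₁) (meshPoint E.δ y₂)) ∧ (ω ∩ (discreteDomainGraph E.Ω E.δ).edgeSet) ∈ openConnIn (meshDomain E.Ω E.δ \ (E.zdArcA ∪ E.zdArcB)) c z ∧ j ≤ z 0 ∧ z 0 ≤ j + N ∧ b ≤ z 1 ∧ ((z 1 - b : ℤ) : ℝ) * E.δ ≤ H ∧ (∀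 y : Site 2, (ω ∩ (discreteDomainGraph E.Ω E.δ).edgeSet) ∈ openConnIn (meshDomain E.Ω E.δ \ (E.zdArcA ∪ E.zdArcB)) c y → j ≤ y 0 → y 0 ≤ j + N → b ≤ y 1 → z 1 ≤ y 1) ∧ (j : ℝ) * E.δ + 4 * R ≤ (z 0 : ℝ) * E.δ ∧ (z 0 : ℝ) * E.δ + 4 * R ≤ ((j + N : ℤ) : ℝ) * E.δ} ≤ C * (((N : ℝ) + 1) * E.δ / H + 1) * (H / R) ^ (1 + α)) → ∀ (D : DobrushinDomain) (E : ℝ → DiscreteDobrushin), ZdDiscretisationFamily D E → volume (frontier D.carrier) = 0 → ∀ (a₁ a₂ y₀ η : ℝ), a₁ < a₂ → 0 < η → {z : ℂ | a₁ < z.re ∧ z.re < a₂ ∧ y₀ < z.im ∧ z.im < y₀ + η} ⊆ D.carrier → (∀ z : ℂ, a₁ < z.re → z.re < a₂ → y₀ - η < z.im → z.im ≤ y₀ → z ∉ D.carrier) → (∀ z : ℂ, a₁ ≤ z.re → z.re ≤ a₂ → y₀ ≤ z.im → z.im ≤ y₀ + η → η ≤ Metric.infDist z (D.arc 1)) → ∀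 L : ℝ, 0 < L → ∀ θ : ℝ, 0 < θ → ∃ ρ : ℝ, 0 < ρ ∧ ∀ᶠ δ in 𝓝[>] (0 : ℝ), (bondPercolation (zdGraph 2) half).real {ω | ∃ c y y₁ y₂ : Site 2, c ∈ meshDomain (E δ).Ω (E δ).δ ∧ c ∉ (E δ).zdArcA ∪ (E δ).zdArcB ∧ (¬ ∃ u u' : Site 2, u' ∈ (E δ).zdArcA ∧ u ∉ (E δ).zdArcA ∪ (E δ).zdArcB ∧ s(u, u') ∈ ω ∧ s(u, u') ∈ (discreteDomainGraph (E δ).Ω (E δ).δ).edgeSet ∧ (ω ∩ (discreteDomainGraph (E δ).Ω (E δ).δ).edgeSet) ∈ openConnIn (meshDomain (E δ).Ω (E δ).δ \ ((E δ).zdArcA ∪ (E δ).zdArcB)) c u) ∧ (ω ∩ (discreteDomainGraph (E δ).Ω (E δ).δ).edgeSet) ∈ openConnIn (meshDomain (E δ).Ω (E δ).δ \ ((E δ).zdArcA ∪ (E δ).zdArcB)) c y ∧ a₁ + 3 * η ≤ (meshPoint (E δ).δ y).re ∧ (meshPoint (E δ).δ y).re ≤ a₂ - 3 * η ∧ y₀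 < (meshPoint (E δ).δ y).im ∧ (meshPoint (E δ).δ y).im ≤ y₀ + ρ ∧ (ω ∩ (discreteDomainGraph (E δ).Ω (E δ).δ).edgeSet) ∈ openConnIn (meshDomain (E δ).Ω (E δ).δ \ ((E δ).zdArcA ∪ (E δ).zdArcB)) c y₁ ∧ (ω ∩ (discreteDomainGraph (E δ).Ω (E δ).δ).edgeSet) ∈ openConnIn (meshDomain (E δ).Ω (E δ).δ \ ((E δ).zdArcA ∪ (E δ).zdArcB)) c y₂ ∧ L ≤ dist (meshPoint (E δ).δ y₁) (meshPoint (E δ).δ y₂)} < θ := by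
  intro hS D E hfam hnull a₁ a₂ y₀ η ha hη hslab hbelow hfar L hL θ hθ
  obtain ⟨C, α, hC, hα, H₀, K, hH₀, hK, hSb⟩ := hS
  obtain ⟨αc, c₀, hαc, hc₀, hcor⟩ := stub_kernel_cornerNearMiss
  -- degenerate pieces: the target event is empty
  rcases lt_or_ge (a₂ - 3 * η) (a₁ + 3 * η) with hdeg | hwide
  · refine ⟨1, one_pos, Filter.Eventually.of_forall fun δ => ?_⟩
    refine lt_of_le_of_lt (measureReal_mono (fun ω hω => ?_) (measure_ne_top _ _))
      (by rw [measureReal_empty]; exact hθ)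
    obtain ⟨c, y, y₁, y₂, -, -, -, -, h1, h2, -⟩ := hω
    exact (not_le.2 hdeg (h1.trans h2)).elim
  -- the constants `t`, `R`, `ρ`
  obtain ⟨t, ht0, ht1, htθ⟩ := exists_corner_const hαc hθ
  have hηt : 0 < η * t := mul_pos hη ht0
  obtain ⟨R, hR0, hRL, hRη⟩ : ∃ R : ℝ, 0 < R ∧ 6 * R ≤ L ∧ 16 * R ≤ η * t :=
    ⟨min (L / 6) (η * t / 16), lt_min (by positivity) (by positivity),
      by linarith [min_le_left (L / 6) (η * t / 16)],
      by linarith [min_le_right (L / 6) (η * t / 16)]⟩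
  have hRη' : 16 * R ≤ η := hRη.trans (mul_le_of_le_one_right hη.le ht1)
  obtain ⟨ρ, hρ0, hρK, hρθ⟩ := exists_strip_const hC hα hR0 hK (sub_nonneg.2 ha.le) hθ
  have hρR : 2 * ρ ≤ R := le_trans (by nlinarith) hρK
  have hgap : 0 < (η / 2 - 4 * R - ρ) / 6 := by
    apply div_pos _ (by norm_num)
    linarith
  refine ⟨ρ, hρ0, ?_⟩
  filter_upwards [stub_kernel_flatPieceGeometry D E hfam hnull a₁ a₂ y₀ η ha hη hslab hbelow hfar,
    hfam.eventually_isZdAdmissible, self_mem_nhdsWithin,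
    eventually_le_nhdsGT (div_pos hρ0 (lt_of_lt_of_le one_pos hH₀) : 0 < ρ / H₀),
    eventually_le_nhdsGT (div_pos (by positivity) hc₀ : 0 < 5 * R / c₀),
    eventually_le_nhdsGT hgap, eventually_le_nhdsGT hρ0, eventually_le_nhdsGT hη]
    with δ hgeom hadm hδ0 hδ1 hδ2 hδ3 hδ4 hδ5
  have hδ : (0 : ℝ) < δ := hδ0
  have hd : (E δ).δ = δ := hfam.δ_eq δ
  -- the lattice box
  obtain ⟨hj1, hj2⟩ := ceil_row_bounds hδ (a₁ + 3 * η / 2)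
  obtain ⟨hb1, hb2⟩ := floor_row_bounds hδ y₀
  set j : ℤ := ⌈(a₁ + 3 * η / 2) / δ⌉ with hj
  have hNnn : 0 ≤ (a₂ - 3 * η / 2 - δ * j) / δ := div_nonneg (by linarith) hδ.le
  set N : ℕ := ⌊(a₂ - 3 * η / 2 - δ * j) / δ⌋₊ with hN
  have hNle : (N : ℝ) * δ ≤ a₂ - 3 * η / 2 - δ * j := (le_div_iff₀ hδ).1 (Nat.floor_le hNnn)
  have hNgt : a₂ - 3 * η / 2 - δ * j < ((N : ℝ) + 1) * δ :=
    (div_lt_iff₀ hδ).1 (Nat.lt_floor_add_one _)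
  have hMnn : 0 ≤ (4 * R + ρ + 2 * δ) / δ := by positivity
  set M : ℕ := ⌈(4 * R + ρ + 2 * δ) / δ⌉₊ with hM
  have hMge : 4 * R + ρ + 2 * δ ≤ (M : ℝ) * δ := (div_le_iff₀ hδ).1 (Nat.le_ceil _)
  have hMlt : ((M : ℝ) - 1) * δ < 4 * R + ρ + 2 * δ := by
    rw [← lt_div_iff₀ hδ]
    linarith [Nat.ceil_lt_add_one hMnn]
  have hN1 : 1 ≤ N := by
    have h : (2 : ℝ) * δ < ((N : ℝ) + 1) * δ := by linarith
    have h' := lt_of_mul_lt_mul_right h hδ.le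
    exact_mod_cast (show (1 : ℝ) < N by linarith).le
  -- flat geometry of the box
  obtain ⟨hF1, hF3⟩ := hgeom j N M (by push_cast; linarith) (by push_cast; linarith)
    (by linarith)
  -- the strip term
  have hA := hSb (E δ) hadm (⌊y₀ / δ⌋ + 2) j N M ρ R hN1
    (by rw [hd, mul_comm]; exact (le_div_iff₀ (lt_of_lt_of_le one_pos hH₀)).1 hδ1)
    (by nlinarith) hF1 hF3 (by rw [hd]; linarith)
  have hA' : _ ≤ θ / 4 := hA.trans (by
    rw [hd]
    refine le_trans ?_ hρθ
    have hNδ : ((N : ℝ) + 1) * δ ≤ a₂ - a₁ := by linarith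
    gcongr)
  -- the two corner terms
  have hc₀δ : c₀ * (E δ).δ ≤ 5 * R := by
    rw [hd, mul_comm]; exact (le_div_iff₀ hc₀).1 hδ2
  have hbase : (5 * R / (3 * η / 2)) ^ αc ≤ θ / 4 :=
    (Real.rpow_le_rpow (by positivity) (by rw [div_le_iff₀ (by positivity)]; linarith)
      hαc.le).trans htθ
  have hB' := (hcor (E δ) ⟨a₁ + 3 * η / 2, y₀⟩ (5 * R) (3 * η / 2) (by rw [hd]; exact hδ) hc₀δ
    (by linarith)).trans hbase
  have hC' := (hcor (E δ) ⟨a₂ - 3 * η / 2, y₀⟩ (5 * R) (3 * η / 2) (by rw [hd]; exact hδ) hc₀δ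
    (by linarith)).trans hbase
  -- the trichotomy and the union bound
  have hsub := trichotomy (E := E δ) (a₁ := a₁) (a₂ := a₂) (y₀ := y₀) (η := η) (ρ := ρ)
    (R := R) (L := L) hd hδ hRL (by linarith)
    (by linarith) hδ5 (by push_cast; linarith) (by push_cast; linarith)
    (by linarith) (by linarith) (by push_cast; linarith)
    (by push_cast; linarith) hF1
  have hBC := (measureReal_union_le _ _).trans (add_le_add hB' hC')
  have hABC := (measureReal_union_le _ _).trans (add_le_add hA' hBC)
  exact ((measureReal_mono hsub (measure_ne_top _ _)).trans hABC).trans_lt (by linarith)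

end Summit.CriticalPhenomena.CardyFormulaZ2.Cruxes.LagHandOff.HittingTournament

end
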